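import Mathlib.Geometry.Euclidean.Inversion.Calculus
import Mathlib.Analysis.InnerProductSpace.Projection.FiniteDimensional
import Mathlib.Analysis.InnerProductSpace.PiL2
import Mathlib.MeasureTheory.Function.Jacobian
import Mathlib.MeasureTheory.Measure.Haar.InnerProductSpace
import HarnessLib

/-!
# Letters for the Sobolev transport under the planar inversion (ROAD (W), brick W-INV, part 1)

Helper file (K2 lane of crux `stmt-QuantumFields-19936` `HistoryTailL` ∕ crux `stmt-QuantumFields-23533`
`BlockLipschitzL`, LINE 25 «CompactnessTransfer», ROAD (W) «the H-system energy gap at `3π` from the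
sharp two-point Wente bound», brick W-INV).  YM₃ on the unit 3-torus is rung R3 of the ladder — NOT
`d = 4`, NOT infinite volume, NOT a mass gap, NOT the Clay problem; nothing here bears on those.

Elementary calculus and measure theory of the inversion `M = EuclideanGeometry.inversion c 1` of the
plane `E² = EuclideanSpace ℝ (Fin 2)` in the unit circle about `c` (Mathlib: `M x = (1 / dist x c)² • (x − c) + c`,
`DM(x) = (1 / dist x c)² • reflection (ℝ ∙ (x − c))ᗮ`, `hasFDerivAt_inversion`):

* §1 the derivative: explicit formula `DM(x) v = ‖x − c‖⁻² (v − 2⟪x − c, v⟫ ‖x − c‖⁻² (x − c))`,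
  conformality `⟪DM v, DM w⟫ = ‖x−c‖⁻⁴ ⟪v, w⟫`, symmetry, the involution identities
  `DM(x) (DM(M x) w) = w` and `‖x − c‖⁻⁴ • DM(M x) = DM(x)`;
* §2 the PIOLA ∕ HARMONICITY identity of the plane: for every `v` the vector field `x ↦ DM(x) v` is
  divergence free on `{c}ᶜ` (its components are `∂ᵢ⟪M x, v⟫` and the inversion is harmonic in two
  dimensions) — the algebraic reason why weak derivatives transport under `M` (part 2);
* §3 the Jacobian `|det DM(x)| = ‖x − c‖⁻⁴` (dimension two, `Submodule.det_reflection`) and the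
  change of variables `∫ ‖y − c‖⁻⁴ • g (M y) dy = ∫ g` (Mathlib's
  `integral_image_eq_integral_abs_det_fderiv_smul` on `{c}ᶜ`, which `M` maps onto itself), with its
  `lintegral` and integrability forms.

References: H. Brezis, J.-M. Coron, Arch. Rational Mech. Anal. 89 (1985), Appendix p. 48 (the inversion
step); L. C. Evans, *PDE* (2010), §C.4 (change of variables).
-/

noncomputable section

open MeasureTheory Set Filter Metric Module EuclideanGeometry
open scoped ENNReal Topology RealInnerProductSpace

namespace Summit.QuantumFields.YangMills.Theorems.PoincareLipschitzSobolevInversion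

/-! ## §1 The derivative of the inversion -/

section Derivative

variable {F : Type*} [NormedAddCommGroup F] [InnerProductSpace ℝ F]

/-- Reflection in the hyperplane orthogonal to `z`: `v ↦ v − 2⟪z, v⟫ ‖z‖⁻² z`. [folklore] -/
theorem reflection_orthogonal_singleton_apply (z v : F) :
    (ℝ ∙ z)ᗮ.reflection v = v - (2 * ⟪z, v⟫ / ‖z‖ ^ 2) • z := by
  rw [Submodule.reflection_orthogonal_apply, Submodule.reflection_singleton_apply, neg_sub, two_smul,
    ← add_smul]
  congr 1
  simp only [RCLike.ofReal_real_eq_id, id_eq]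
  ring

/-- The coercion of the reflection to a continuous linear map, applied. [folklore] -/
theorem reflection_clm_apply (K : Submodule ℝ F) [K.HasOrthogonalProjection] (v : F) :
    (K.reflection : F →L[ℝ] F) v = K.reflection v := rfl

/-- The Fréchet derivative of the inversion off the centre (Mathlib's `hasFDerivAt_inversion`).
[folklore] -/
theorem fderiv_inversion {c x : F} (hx : x ≠ c) (R : ℝ) :
    fderiv ℝ (inversion c R) x = (R / dist x c) ^ 2 • ((ℝ ∙ (x - c))ᗮ.reflection : F →L[ℝ] F) :=
  (hasFDerivAt_inversion (R := R) hx).fderiv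

/-- Explicit formula: `DM(x) v = ‖x − c‖⁻² (v − 2⟪x − c, v⟫ ‖x − c‖⁻² (x − c))` for the unit
inversion. [folklore] -/
theorem fderiv_inversion_apply {c x : F} (hx : x ≠ c) (v : F) :
    fderiv ℝ (inversion c 1) x v =
      (‖x - c‖ ^ 2)⁻¹ • (v - (2 * ⟪x - c, v⟫ / ‖x - c‖ ^ 2) • (x - c)) := by
  rw [fderiv_inversion hx, _root_.smul_apply, reflection_clm_apply,
    reflection_orthogonal_singleton_apply, dist_eq_norm, one_div, inv_pow]

omit [InnerProductSpace ℝ F] in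
/-- The scalar factor `(1 / dist x c)² = ‖x − c‖⁻²` is positive off the centre (any normed group). [folklore] -/
theorem inv_norm_sq_pos {F : Type*} [NormedAddCommGroup F] {c x : F} (hx : x ≠ c) : 0 < (‖x - c‖ ^ 2)⁻¹ :=
  inv_pos.2 (pow_pos (norm_pos_iff.2 (sub_ne_zero.2 hx)) 2)

/-- Reflections are involutive: `S (S v) = v`. [folklore] -/
theorem reflection_reflection_apply (z v : F) : (ℝ ∙ z)ᗮ.reflection ((ℝ ∙ z)ᗮ.reflection v) = v :=
  Submodule.reflection_reflection _ v

/-- **Conformality**: `⟪DM(x) v, DM(x) w⟫ = ‖x − c‖⁻⁴ ⟪v, w⟫`. [folklore] -/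
theorem inner_fderiv_inversion {c x : F} (hx : x ≠ c) (v w : F) :
    ⟪fderiv ℝ (inversion c 1) x v, fderiv ℝ (inversion c 1) x w⟫ =
      ((‖x - c‖ ^ 2)⁻¹) ^ 2 * ⟪v, w⟫ := by
  rw [fderiv_inversion hx]
  simp only [_root_.smul_apply, reflection_clm_apply,
    real_inner_smul_left, real_inner_smul_right, LinearIsometryEquiv.inner_map_map, dist_eq_norm, one_div,
    inv_pow]
  ring

/-- `‖DM(x) v‖ = ‖x − c‖⁻² ‖v‖`. [folklore] -/
theorem norm_fderiv_inversion_apply {c x : F} (hx : x ≠ c) (v : F) :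
    ‖fderiv ℝ (inversion c 1) x v‖ = (‖x - c‖ ^ 2)⁻¹ * ‖v‖ := by
  rw [fderiv_inversion hx, _root_.smul_apply, norm_smul, reflection_clm_apply,
    LinearIsometryEquiv.norm_map, dist_eq_norm, one_div, inv_pow,
    Real.norm_of_nonneg (inv_nonneg.2 (sq_nonneg _))]

/-- **Symmetry**: `⟪DM(x) v, w⟫ = ⟪v, DM(x) w⟫` (a multiple of a reflection). [folklore] -/
theorem inner_fderiv_inversion_left {c x : F} (hx : x ≠ c) (v w : F) :
    ⟪fderiv ℝ (inversion c 1) x v, w⟫ = ⟪v, fderiv ℝ (inversion c 1) x w⟫ := by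
  rw [fderiv_inversion_apply hx, fderiv_inversion_apply hx]
  simp only [real_inner_smul_left, real_inner_smul_right, inner_sub_left, inner_sub_right,
    real_inner_comm (x - c)]
  ring

/-- The inverted point: `M x − c = ‖x − c‖⁻² (x − c)`. [folklore] -/
theorem inversion_sub_center (c x : F) : inversion c 1 x - c = (‖x - c‖ ^ 2)⁻¹ • (x - c) := by
  rw [inversion, dist_eq_norm, one_div, inv_pow, vsub_eq_sub, vadd_eq_add, add_sub_cancel_right]

/-- `‖M x − c‖² = (‖x − c‖²)⁻¹` off the centre. [folklore] -/
theorem norm_inversion_sub_center_sq {c x : F} (hx : x ≠ c) :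
    ‖inversion c 1 x - c‖ ^ 2 = (‖x - c‖ ^ 2)⁻¹ := by
  have h0 : ‖x - c‖ ≠ 0 := norm_ne_zero_iff.2 (sub_ne_zero.2 hx)
  rw [inversion_sub_center, norm_smul, Real.norm_of_nonneg (inv_nonneg.2 (sq_nonneg _)), mul_pow]
  field_simp

/-- The inversion maps `{c}ᶜ` to itself. [folklore] -/
theorem inversion_ne_center {c x : F} (hx : x ≠ c) : inversion c 1 x ≠ c :=
  fun h => hx ((inversion_eq_center one_ne_zero).1 h)

/-- The unit inversion is an involution (Mathlib). [folklore] -/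
theorem inversion_inversion_one (c x : F) : inversion c 1 (inversion c 1 x) = x :=
  inversion_inversion c one_ne_zero x

/-- `DM` at the inverted point: `‖x − c‖⁻⁴ • DM(M x) = DM(x)` (the reflections agree, the scalar
factors are reciprocal). [folklore] -/
theorem sq_smul_fderiv_inversion_inversion_apply {c x : F} (hx : x ≠ c) (w : F) :
    ((‖x - c‖ ^ 2)⁻¹) ^ 2 • fderiv ℝ (inversion c 1) (inversion c 1 x) w = fderiv ℝ (inversion c 1) x w := by
  have hx' : inversion c 1 x ≠ c := inversion_ne_center hx
  have h0 : ‖x - c‖ ≠ 0 := norm_ne_zero_iff.2 (sub_ne_zero.2 hx)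
  rw [fderiv_inversion_apply hx', fderiv_inversion_apply hx, norm_inversion_sub_center_sq hx,
    inversion_sub_center, inv_inv, real_inner_smul_left, smul_smul, smul_smul]
  have h1 : (‖x - c‖ ^ 2)⁻¹ ^ 2 * ‖x - c‖ ^ 2 = (‖x - c‖ ^ 2)⁻¹ := by field_simp
  have h2 : 2 * ((‖x - c‖ ^ 2)⁻¹ * ⟪x - c, w⟫) / (‖x - c‖ ^ 2)⁻¹ * (‖x - c‖ ^ 2)⁻¹ =
      2 * ⟪x - c, w⟫ / ‖x - c‖ ^ 2 := by field_simp
  rw [h1, h2]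

/-- The involution identity `DM(x) (DM(M x) w) = w` (differentiate `M ∘ M = id`; here by the
explicit formulas). [folklore] -/
theorem fderiv_inversion_apply_fderiv_inversion_inversion {c x : F} (hx : x ≠ c) (w : F) :
    fderiv ℝ (inversion c 1) x (fderiv ℝ (inversion c 1) (inversion c 1 x) w) = w := by
  have hx' : inversion c 1 x ≠ c := inversion_ne_center hx
  have h0 : ‖x - c‖ ≠ 0 := norm_ne_zero_iff.2 (sub_ne_zero.2 hx)
  -- `DM(M x) = ‖x-c‖⁴ • DM(x)` and `DM(x) ∘ DM(x) = ‖x-c‖⁻⁴ • id`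
  have h1 : fderiv ℝ (inversion c 1) (inversion c 1 x) w = (‖x - c‖ ^ 2) ^ 2 • fderiv ℝ (inversion c 1) x w := by
    rw [← sq_smul_fderiv_inversion_inversion_apply hx w, smul_smul]
    rw [show (‖x - c‖ ^ 2) ^ 2 * ((‖x - c‖ ^ 2)⁻¹) ^ 2 = 1 by field_simp, one_smul]
  rw [h1, map_smul, fderiv_inversion hx]
  simp only [_root_.smul_apply, reflection_clm_apply, map_smul, dist_eq_norm, one_div, inv_pow,
    smul_smul, reflection_reflection_apply]
  conv_rhs => rw [← one_smul ℝ w]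
  congr 1
  field_simp

/-- Chain rule through the inversion, solved for the outer derivative:
if `η = θ ∘ M` near `x ≠ c` then `Dθ(M x) v = Dη(x) (DM(M x) v)`. [folklore] -/
theorem fderiv_comp_inversion_apply {G : Type*} [NormedAddCommGroup G] [NormedSpace ℝ G]
    {c x : F} (hx : x ≠ c) {θ : F → G} (hθ : DifferentiableAt ℝ θ (inversion c 1 x)) (v : F) :
    fderiv ℝ θ (inversion c 1 x) v =
      fderiv ℝ (fun y => θ (inversion c 1 y)) x (fderiv ℝ (inversion c 1) (inversion c 1 x) v) := by
  have hM : DifferentiableAt ℝ (inversion c 1) x := (hasFDerivAt_inversion (R := 1) hx).differentiableAt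
  rw [fderiv_fun_comp x hθ hM, ContinuousLinearMap.comp_apply, fderiv_inversion_apply_fderiv_inversion_inversion hx]

end Derivative

/-! ## §2 The plane: coordinates, the Jacobian, harmonicity of the inversion -/

section Plane

/-- Expansion of a linear functional on `E²` along the standard basis. [folklore] -/
theorem clm_apply_eq_sum {G : Type*} [NormedAddCommGroup G] [NormedSpace ℝ G]
    (L : EuclideanSpace ℝ (Fin 2) →L[ℝ] G) (w : EuclideanSpace ℝ (Fin 2)) :
    L w = ∑ i : Fin 2, w i • L (EuclideanSpace.single i 1) := by
  conv_lhs => rw [← (EuclideanSpace.basisFun (Fin 2) ℝ).sum_repr w]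
  simp only [map_sum, map_smul, EuclideanSpace.basisFun_repr, EuclideanSpace.basisFun_apply]

/-- **The Jacobian of the planar inversion**: `|det DM(x)| = ‖x − c‖⁻⁴`. [folklore] -/
theorem abs_det_fderiv_inversion {c x : EuclideanSpace ℝ (Fin 2)} (hx : x ≠ c) :
    |(fderiv ℝ (inversion c 1) x).det| = ((‖x - c‖ ^ 2)⁻¹) ^ 2 := by
  have hz : x - c ≠ 0 := sub_ne_zero.2 hx
  rw [fderiv_inversion hx, ContinuousLinearMap.det, ContinuousLinearMap.toLinearMap_smul,
    LinearMap.det_smul, finrank_euclideanSpace, Fintype.card_fin]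
  have hdet : LinearMap.det (((ℝ ∙ (x - c))ᗮ.reflection : EuclideanSpace ℝ (Fin 2) →L[ℝ]
      EuclideanSpace ℝ (Fin 2)) : EuclideanSpace ℝ (Fin 2) →ₗ[ℝ] EuclideanSpace ℝ (Fin 2)) = -1 := by
    have h := Submodule.det_reflection (K := (ℝ ∙ (x - c))ᗮ)
    rw [Submodule.orthogonal_orthogonal, finrank_span_singleton hz, pow_one] at h
    exact h
  rw [hdet, dist_eq_norm, one_div, inv_pow, mul_neg_one, abs_neg, abs_of_nonneg (sq_nonneg _)]

/-- The planar inversion maps `{c}ᶜ` onto itself. [folklore] -/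
theorem image_inversion_compl (c : EuclideanSpace ℝ (Fin 2)) : inversion c 1 '' {c}ᶜ = {c}ᶜ := by
  ext y
  constructor
  · rintro ⟨x, hx, rfl⟩
    exact inversion_ne_center hx
  · intro hy
    exact ⟨inversion c 1 y, inversion_ne_center hy, inversion_inversion_one c y⟩

/-- **Change of variables for the planar inversion, `lintegral` form**:
`∫⁻ ‖y − c‖⁻⁴ · g (M y) dy = ∫⁻ g`. [cite: Evans2010, §C.4 Thm. 2 (change of variables)] -/
theorem lintegral_comp_inversion (c : EuclideanSpace ℝ (Fin 2)) (g : EuclideanSpace ℝ (Fin 2) → ℝ≥0∞) :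
    ∫⁻ y, ENNReal.ofReal (((‖y - c‖ ^ 2)⁻¹) ^ 2) * g (inversion c 1 y) = ∫⁻ x, g x := by
  have hs : MeasurableSet ({c}ᶜ : Set (EuclideanSpace ℝ (Fin 2))) := (measurableSet_singleton c).compl
  have hd : ∀ x ∈ ({c}ᶜ : Set (EuclideanSpace ℝ (Fin 2))),
      HasFDerivWithinAt (inversion c 1) (fderiv ℝ (inversion c 1) x) {c}ᶜ x := fun x hx =>
    ((hasFDerivAt_inversion (R := 1) hx).differentiableAt.hasFDerivAt).hasFDerivWithinAt
  have hinj : InjOn (inversion c 1) ({c}ᶜ : Set (EuclideanSpace ℝ (Fin 2))) :=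
    (inversion_injective c one_ne_zero).injOn
  have h := lintegral_image_eq_lintegral_abs_det_fderiv_mul volume hs hd hinj g
  rw [image_inversion_compl, restrict_compl_singleton] at h
  rw [h]
  refine lintegral_congr_ae ?_
  filter_upwards [Measure.ae_ne volume c] with x hx
  rw [abs_det_fderiv_inversion hx]

/-- **Change of variables for the planar inversion, integrability**:
`y ↦ ‖y − c‖⁻⁴ • g (M y)` is integrable iff `g` is. [cite: Evans2010, §C.4 Thm. 2 (change of variables)] -/
theorem integrable_comp_inversion_iff {G : Type*} [NormedAddCommGroup G] [NormedSpace ℝ G]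
    (c : EuclideanSpace ℝ (Fin 2)) (g : EuclideanSpace ℝ (Fin 2) → G) :
    Integrable (fun y => (((‖y - c‖ ^ 2)⁻¹) ^ 2) • g (inversion c 1 y)) ↔ Integrable g := by
  have hs : MeasurableSet ({c}ᶜ : Set (EuclideanSpace ℝ (Fin 2))) := (measurableSet_singleton c).compl
  have hd : ∀ x ∈ ({c}ᶜ : Set (EuclideanSpace ℝ (Fin 2))),
      HasFDerivWithinAt (inversion c 1) (fderiv ℝ (inversion c 1) x) {c}ᶜ x := fun x hx =>
    ((hasFDerivAt_inversion (R := 1) hx).differentiableAt.hasFDerivAt).hasFDerivWithinAt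
  have hinj : InjOn (inversion c 1) ({c}ᶜ : Set (EuclideanSpace ℝ (Fin 2))) :=
    (inversion_injective c one_ne_zero).injOn
  have h := integrableOn_image_iff_integrableOn_abs_det_fderiv_smul volume hs hd hinj g
  rw [image_inversion_compl, IntegrableOn, IntegrableOn, restrict_compl_singleton] at h
  rw [h]
  refine integrable_congr ?_
  filter_upwards [Measure.ae_ne volume c] with x hx
  rw [abs_det_fderiv_inversion hx]

/-- **Change of variables for the planar inversion, Bochner form**:
`∫ ‖y − c‖⁻⁴ • g (M y) dy = ∫ g`. [cite: Evans2010, §C.4 Thm. 2 (change of variables)] -/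
theorem integral_comp_inversion {G : Type*} [NormedAddCommGroup G] [NormedSpace ℝ G]
    (c : EuclideanSpace ℝ (Fin 2)) (g : EuclideanSpace ℝ (Fin 2) → G) :
    ∫ y, (((‖y - c‖ ^ 2)⁻¹) ^ 2) • g (inversion c 1 y) = ∫ x, g x := by
  have hs : MeasurableSet ({c}ᶜ : Set (EuclideanSpace ℝ (Fin 2))) := (measurableSet_singleton c).compl
  have hd : ∀ x ∈ ({c}ᶜ : Set (EuclideanSpace ℝ (Fin 2))),
      HasFDerivWithinAt (inversion c 1) (fderiv ℝ (inversion c 1) x) {c}ᶜ x := fun x hx =>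
    ((hasFDerivAt_inversion (R := 1) hx).differentiableAt.hasFDerivAt).hasFDerivWithinAt
  have hinj : InjOn (inversion c 1) ({c}ᶜ : Set (EuclideanSpace ℝ (Fin 2))) :=
    (inversion_injective c one_ne_zero).injOn
  have h := integral_image_eq_integral_abs_det_fderiv_smul volume hs hd hinj g
  rw [image_inversion_compl, restrict_compl_singleton] at h
  rw [h]
  refine integral_congr_ae ?_
  filter_upwards [Measure.ae_ne volume c] with x hx
  rw [abs_det_fderiv_inversion hx]

/-- The **inverse form** of the change of variables: `∫ g (M y) dy = ∫ ‖x − c‖⁻⁴ • g x dx`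
(apply the direct form to `‖·−c‖⁻⁴ • g` and use `‖M y − c‖² = ‖y − c‖⁻²`).
[cite: Evans2010, §C.4 Thm. 2 (change of variables)] -/
theorem integral_comp_inversion' {G : Type*} [NormedAddCommGroup G] [NormedSpace ℝ G]
    (c : EuclideanSpace ℝ (Fin 2)) (g : EuclideanSpace ℝ (Fin 2) → G) :
    ∫ y, g (inversion c 1 y) = ∫ x, (((‖x - c‖ ^ 2)⁻¹) ^ 2) • g x := by
  rw [← integral_comp_inversion c (fun x => (((‖x - c‖ ^ 2)⁻¹) ^ 2) • g x)]
  refine integral_congr_ae ?_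
  filter_upwards [Measure.ae_ne volume c] with y hy
  have h0 : ‖y - c‖ ≠ 0 := norm_ne_zero_iff.2 (sub_ne_zero.2 hy)
  rw [norm_inversion_sub_center_sq hy, inv_inv, smul_smul]
  rw [show ((‖y - c‖ ^ 2)⁻¹) ^ 2 * (‖y - c‖ ^ 2) ^ 2 = 1 by field_simp, one_smul]

end Plane

/-! ## §3 Harmonicity: the fields `x ↦ DM(x) v` are divergence free -/

section Piola

/-- The components of `x ↦ DM(x) v` as explicit functions:
`(DM(x) v)ᵢ = ‖x−c‖⁻² vᵢ − 2⟪x−c, v⟫ ‖x−c‖⁻⁴ (x−c)ᵢ`. [folklore] -/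
theorem fderiv_inversion_apply_coord {c x : EuclideanSpace ℝ (Fin 2)} (hx : x ≠ c)
    (v : EuclideanSpace ℝ (Fin 2)) (i : Fin 2) :
    fderiv ℝ (inversion c 1) x v i =
      (‖x - c‖ ^ 2)⁻¹ * v i - 2 * ⟪x - c, v⟫ * ((‖x - c‖ ^ 2)⁻¹) ^ 2 * (x - c) i := by
  have h0 : ‖x - c‖ ≠ 0 := norm_ne_zero_iff.2 (sub_ne_zero.2 hx)
  rw [fderiv_inversion_apply hx]
  simp only [PiLp.smul_apply, PiLp.sub_apply, smul_eq_mul]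
  field_simp

/-- The component functions `x ↦ ‖x−c‖⁻² vᵢ − 2⟪x−c, v⟫ ‖x−c‖⁻⁴ (x−c)ᵢ` are smooth off the centre.
[folklore] -/
theorem contDiffAt_inversionField_coord {c x : EuclideanSpace ℝ (Fin 2)} (hx : x ≠ c)
    (v : EuclideanSpace ℝ (Fin 2)) (i : Fin 2) {n : WithTop ℕ∞} :
    ContDiffAt ℝ n (fun y : EuclideanSpace ℝ (Fin 2) =>
        (‖y - c‖ ^ 2)⁻¹ * v i - 2 * ⟪y - c, v⟫ * ((‖y - c‖ ^ 2)⁻¹) ^ 2 * (y - c) i) x := by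
  have hz : ‖x - c‖ ^ 2 ≠ 0 := pow_ne_zero 2 (norm_ne_zero_iff.2 (sub_ne_zero.2 hx))
  have h1 : ContDiffAt ℝ n (fun y : EuclideanSpace ℝ (Fin 2) => ‖y - c‖ ^ 2) x :=
    (contDiffAt_id.sub contDiffAt_const).norm_sq ℝ
  have h2 : ContDiffAt ℝ n (fun y : EuclideanSpace ℝ (Fin 2) => (‖y - c‖ ^ 2)⁻¹) x := h1.inv hz
  have h4 : ContDiffAt ℝ n (fun y : EuclideanSpace ℝ (Fin 2) => ⟪y - c, v⟫) x :=
    (contDiffAt_id.sub contDiffAt_const).inner ℝ contDiffAt_const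
  have h5 : ContDiffAt ℝ n (fun y : EuclideanSpace ℝ (Fin 2) => (y - c) i) x := by
    have h : ContDiffAt ℝ n (fun y : EuclideanSpace ℝ (Fin 2) => (EuclideanSpace.proj i) y - c i) x :=
      (EuclideanSpace.proj (𝕜 := ℝ) i).contDiff.contDiffAt.sub contDiffAt_const
    refine h.congr_of_eventuallyEq (Eventually.of_forall fun y => ?_)
    simp
  exact (h2.mul contDiffAt_const).sub (((contDiffAt_const.mul h4).mul (h2.pow 2)).mul h5)

/-- The derivative along `eᵢ` of the `i`-th component function, as an explicit number:
`∂ᵢ (DM(·) v)ᵢ (x) = −2(x−c)ᵢ vᵢ ‖x−c‖⁻⁴ − 2 vᵢ (x−c)ᵢ ‖x−c‖⁻⁴ + 8⟪x−c,v⟫ (x−c)ᵢ² ‖x−c‖⁻⁶ − 2⟪x−c,v⟫ ‖x−c‖⁻⁴`.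
[folklore] -/
theorem fderiv_inversionField_coord_apply_single {c x : EuclideanSpace ℝ (Fin 2)} (hx : x ≠ c)
    (v : EuclideanSpace ℝ (Fin 2)) (i : Fin 2) :
    fderiv ℝ (fun y : EuclideanSpace ℝ (Fin 2) =>
        (‖y - c‖ ^ 2)⁻¹ * v i - 2 * ⟪y - c, v⟫ * ((‖y - c‖ ^ 2)⁻¹) ^ 2 * (y - c) i) x
      (EuclideanSpace.single i 1) =
      -(((‖x - c‖ ^ 2)⁻¹) ^ 2 * (2 * (x - c) i)) * v i
        - (2 * v i * ((‖x - c‖ ^ 2)⁻¹) ^ 2 * (x - c) i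
          + 2 * ⟪x - c, v⟫ * (2 * (‖x - c‖ ^ 2)⁻¹ * (-(((‖x - c‖ ^ 2)⁻¹) ^ 2 * (2 * (x - c) i)))) * (x - c) i
          + 2 * ⟪x - c, v⟫ * ((‖x - c‖ ^ 2)⁻¹) ^ 2 * 1) := by
  have hz : ‖x - c‖ ^ 2 ≠ 0 := pow_ne_zero 2 (norm_ne_zero_iff.2 (sub_ne_zero.2 hx))
  -- `y ↦ ‖y - c‖²`
  have h1 : HasFDerivAt (fun y : EuclideanSpace ℝ (Fin 2) => ‖y - c‖ ^ 2)
      (2 • (innerSL ℝ (x - c)).comp (ContinuousLinearMap.id ℝ (EuclideanSpace ℝ (Fin 2)))) x :=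
    ((hasFDerivAt_id x).sub_const c).norm_sq
  -- `y ↦ (‖y - c‖²)⁻¹`
  have h2 : HasFDerivAt (fun y : EuclideanSpace ℝ (Fin 2) => (‖y - c‖ ^ 2)⁻¹)
      ((ContinuousLinearMap.toSpanSingleton ℝ (-((‖x - c‖ ^ 2) ^ 2)⁻¹)).comp
        (2 • (innerSL ℝ (x - c)).comp (ContinuousLinearMap.id ℝ (EuclideanSpace ℝ (Fin 2))))) x :=
    (hasFDerivAt_inv hz).comp x h1
  -- `y ↦ ⟪y - c, v⟫`
  have h4 : HasFDerivAt (fun y : EuclideanSpace ℝ (Fin 2) => ⟪y - c, v⟫)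
      ((innerSL ℝ v).comp (ContinuousLinearMap.id ℝ (EuclideanSpace ℝ (Fin 2)))) x := by
    have h := ((innerSL ℝ v).hasFDerivAt).comp x ((hasFDerivAt_id x).sub_const c)
    refine h.congr_of_eventuallyEq (Eventually.of_forall fun y => ?_)
    simp only [Function.comp_apply, id_eq, innerSL_apply_apply]
    exact real_inner_comm _ _
  -- `y ↦ (y - c) i`
  have h5 : HasFDerivAt (fun y : EuclideanSpace ℝ (Fin 2) => (y - c) i)
      (EuclideanSpace.proj i : EuclideanSpace ℝ (Fin 2) →L[ℝ] ℝ) x := by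
    have h := ((EuclideanSpace.proj (𝕜 := ℝ) i).hasFDerivAt (x := x)).sub_const (c i)
    refine h.congr_of_eventuallyEq (Eventually.of_forall fun y => ?_)
    simp
  have hW : HasFDerivAt (fun y : EuclideanSpace ℝ (Fin 2) =>
      (‖y - c‖ ^ 2)⁻¹ * v i - 2 * ⟪y - c, v⟫ * ((‖y - c‖ ^ 2)⁻¹) ^ 2 * (y - c) i) _ x :=
    (h2.mul_const (v i)).sub (((h4.const_mul 2).mul (h2.pow 2)).mul h5)
  rw [hW.fderiv]
  simp only [_root_.sub_apply, _root_.add_apply, _root_.smul_apply,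
    ContinuousLinearMap.comp_apply, ContinuousLinearMap.id_apply, ContinuousLinearMap.toSpanSingleton_apply,
    innerSL_apply_apply, EuclideanSpace.inner_single_right, conj_trivial, one_mul, PiLp.proj_apply, smul_eq_mul, Pi.mul_apply,
    nsmul_eq_mul, Nat.cast_ofNat, pow_one, Nat.add_one_sub_one, PiLp.sub_apply]
  have e1 : (EuclideanSpace.single i (1 : ℝ) : EuclideanSpace ℝ (Fin 2)) i = 1 := by simp
  simp only [e1, inv_pow]
  ring

/-- **Harmonicity of the planar inversion (Piola identity)**: for every `v`, the vector field
`x ↦ DM(x) v` is divergence free on `{c}ᶜ` — the sum over `i` of the `i`-th partial derivative of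
its `i`-th component vanishes (the components are `∂ᵢ⟪M x − c, v⟫` and `x ↦ (x − c)/‖x − c‖²` is
harmonic in two dimensions). [folklore] -/
theorem sum_fderiv_inversionField_coord_eq_zero {c x : EuclideanSpace ℝ (Fin 2)} (hx : x ≠ c)
    (v : EuclideanSpace ℝ (Fin 2)) :
    ∑ i : Fin 2, fderiv ℝ (fun y : EuclideanSpace ℝ (Fin 2) =>
        (‖y - c‖ ^ 2)⁻¹ * v i - 2 * ⟪y - c, v⟫ * ((‖y - c‖ ^ 2)⁻¹) ^ 2 * (y - c) i) x
      (EuclideanSpace.single i 1) = 0 := by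
  have hz : ‖x - c‖ ^ 2 ≠ 0 := pow_ne_zero 2 (norm_ne_zero_iff.2 (sub_ne_zero.2 hx))
  simp_rw [fderiv_inversionField_coord_apply_single hx v]
  rw [Fin.sum_univ_two]
  have hn : ‖x - c‖ ^ 2 = (x - c) 0 ^ 2 + (x - c) 1 ^ 2 := by
    rw [EuclideanSpace.real_norm_sq_eq, Fin.sum_univ_two]
  have hi : ⟪x - c, v⟫ = (x - c) 0 * v 0 + (x - c) 1 * v 1 := by
    have : ⟪x - c, v⟫ = ∑ i : Fin 2, v i * (x - c) i := by
      rw [PiLp.inner_apply]; simp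
    rw [this, Fin.sum_univ_two]; ring
  rw [hi]
  rw [hn] at hz ⊢
  field_simp
  ring

end Piola

end Summit.QuantumFields.YangMills.Theorems.PoincareLipschitzSobolevInversion

end
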